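import Summits.NavierStokesRegularity.NavierStokesRegularity.Theorems.TerminalTraceTypeITraceScarL3CaseTwoZoom
import HarnessLib

/-!
# The Case-1 zoom FAMILY at varying regular centres (tool for stub Z4 `stub_caseOneZoom` of the line
# `radius_dichotomy`, item `TerminalTrace.TypeITraceScarL3`, stmt-NavierStokesRegularity-18385)

Seat nsreg-C26-p1 g5 (cell ns-regularity-ideate), `--supports stmt-NavierStokesRegularity-18385`.

`caseOne_family`: from an extinct Type-I apex `(U, P, G)` of class `(M, D₀, C)` and the CASE-1 data of
`radiusDichotomy` (for every `A > 0` a centre `yc`, a radius `0 < r ≤ 1/2`, admissibility `‖U‖ ≤ (r/4)⁻¹` a.e. on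
`Q_{r/4}(0, y')` for all `y' ∈ B(yc, A r)`, and the failure of `‖U‖ ≤ (2r)⁻¹` a.e. on `Q_{2r}(0, yc)`), the zooms
`F_k(s, y) = r_k U(r_k² s, r_k y + yc_k)` (data for `A = k + 4`) are extinct Type-I apices of the SAME class
(translation `apexPackage_translate`, zoom `IsSuitableWeakSolutionInBall.zoomOut`, `HasWeakSpatialGradientOn.stRescale`,
`typeIBound_nsZoom`, `cknD_nsZoom`, `weakNull_nsZoom`), are a.e. bounded by `4` on the late slab piece
`]−1/16, 0[ × B(0, k + 4)` (countably many admissible cylinders `Q_{1/4}(0, y)`), and are NOT a.e. bounded by `1/2`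
on `Q_2(0)` (transport of the failure of `Adm(2 r_k)`).
WHAT THIS IS NOT: 18385 / NS regularity NOT proved. [cite: EscauriazaSereginSverak2003, §3] [cite: Seregin2014, §6.6]
-/

noncomputable section

set_option linter.dupNamespace false

namespace Summit.NavierStokesRegularity.NavierStokesRegularity.Theorems.TypeITraceScarL3

open MeasureTheory Set Function Filter Topology TopologicalSpace Metric InnerProductSpace
open Literature.Analysis.FluidPDE
open scoped NNReal ENNReal RealInnerProductSpace

set_option maxHeartbeats 3200000 in
/-- **The Case-1 zoom family** (see the module docstring). [cite: EscauriazaSereginSverak2003, §3] [cite: Seregin2014, §6.6 Prop. 6.20] -/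
theorem caseOne_family
    {U : ℝ → EuclideanSpace ℝ (Fin 3) → EuclideanSpace ℝ (Fin 3)}
    {P : ℝ → EuclideanSpace ℝ (Fin 3) → ℝ}
    {G : ℝ → EuclideanSpace ℝ (Fin 3) → EuclideanSpace ℝ (Fin 3) →L[ℝ] EuclideanSpace ℝ (Fin 3)}
    {M D₀ : ℝ≥0} {C : ℝ}
    (hsw : ∀ a : ℝ, 0 < a →
      IsSuitableWeakSolutionInBall a (0 : ℝ × EuclideanSpace ℝ (Fin 3)) U P)
    (hG : ∀ a : ℝ, 0 < a →
      HasWeakSpatialGradientOn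
        (parabolicCylinderOpens a (0 : ℝ × EuclideanSpace ℝ (Fin 3))) U G)
    (hI : ∀ a : ℝ, 0 < a →
      typeIBound (parabolicCylinder a (0 : ℝ × EuclideanSpace ℝ (Fin 3))) U P G ≤ M)
    (hD : ∀ z₀ : ℝ × EuclideanSpace ℝ (Fin 3), z₀.1 ≤ 0 →
      ∀ r : ℝ, 0 < r → cknD r z₀ P ≤ D₀)
    (hrate : ∀ s : ℝ, s < 0 →
      ∀ᵐ y : EuclideanSpace ℝ (Fin 3), ‖U s y‖ ≤ C / Real.sqrt (-s))
    (htop : ∀ φ : EuclideanSpace ℝ (Fin 3) → EuclideanSpace ℝ (Fin 3),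
      ContDiff ℝ (⊤ : ℕ∞) φ →
      HasCompactSupport φ → ∀ ε : ℝ, 0 < ε →
      ∃ s₀ : ℝ, s₀ < 0 ∧ ∀ᵐ s ∂(volume.restrict (Ioo s₀ 0)), |∫ y, ⟪U s y, φ y⟫| ≤ ε)
    (hcase : ∀ A : ℝ, 0 < A → ∃ (yc : EuclideanSpace ℝ (Fin 3)) (r : ℝ), 0 < r ∧ r ≤ 1 / 2 ∧
        (∀ y' ∈ ball yc (A * r),
          ∀ᵐ z ∂(volume.restrict (parabolicCylinder (r / 4) (((0 : ℝ), y') : ℝ × EuclideanSpace ℝ (Fin 3)))),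
            ‖U z.1 z.2‖ ≤ (r / 4)⁻¹) ∧
        ¬ (∀ᵐ z ∂(volume.restrict (parabolicCylinder (2 * r) (((0 : ℝ), yc) : ℝ × EuclideanSpace ℝ (Fin 3)))),
            ‖U z.1 z.2‖ ≤ (2 * r)⁻¹)) :
    ∃ (F : ℕ → ℝ → EuclideanSpace ℝ (Fin 3) → EuclideanSpace ℝ (Fin 3))
      (Pk : ℕ → ℝ → EuclideanSpace ℝ (Fin 3) → ℝ)
      (Gk : ℕ → ℝ → EuclideanSpace ℝ (Fin 3) → EuclideanSpace ℝ (Fin 3) →L[ℝ] EuclideanSpace ℝ (Fin 3)),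
      (∀ k (a : ℝ), 0 < a →
        IsSuitableWeakSolutionInBall a (0 : ℝ × EuclideanSpace ℝ (Fin 3)) (F k) (Pk k)) ∧
      (∀ k (a : ℝ), 0 < a →
        HasWeakSpatialGradientOn
          (parabolicCylinderOpens a (0 : ℝ × EuclideanSpace ℝ (Fin 3))) (F k) (Gk k)) ∧
      (∀ k (a : ℝ), 0 < a →
        typeIBound (parabolicCylinder a (0 : ℝ × EuclideanSpace ℝ (Fin 3))) (F k) (Pk k) (Gk k) ≤ M) ∧
      (∀ k (z₀ : ℝ × EuclideanSpace ℝ (Fin 3)), z₀.1 ≤ 0 →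
        ∀ r : ℝ, 0 < r → cknD r z₀ (Pk k) ≤ D₀) ∧
      (∀ k (s : ℝ), s < 0 →
        ∀ᵐ y : EuclideanSpace ℝ (Fin 3), ‖F k s y‖ ≤ C / Real.sqrt (-s)) ∧
      (∀ k, ∀ φ : EuclideanSpace ℝ (Fin 3) → EuclideanSpace ℝ (Fin 3),
        ContDiff ℝ (⊤ : ℕ∞) φ →
        HasCompactSupport φ → ∀ ε : ℝ, 0 < ε →
        ∃ s₀ : ℝ, s₀ < 0 ∧ ∀ᵐ s ∂(volume.restrict (Ioo s₀ 0)), |∫ y, ⟪F k s y, φ y⟫| ≤ ε) ∧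
      (∀ k, ∀ᵐ z ∂(volume.restrict (Ioo (-(1 / 16 : ℝ)) 0 ×ˢ
          ball (0 : EuclideanSpace ℝ (Fin 3)) ((k : ℝ) + 4))), ‖F k z.1 z.2‖ ≤ 4) ∧
      (∀ k, ¬ (∀ᵐ z ∂(volume.restrict (parabolicCylinder 2 (0 : ℝ × EuclideanSpace ℝ (Fin 3)))),
          ‖F k z.1 z.2‖ ≤ 2⁻¹)) := by
  choose yc r hr hrhalf hAdm hnot using fun k : ℕ => hcase ((k : ℝ) + 4) (by positivity)
  -- ## the zoom family
  obtain ⟨F, hF⟩ : ∃ F : ℕ → ℝ → EuclideanSpace ℝ (Fin 3) → EuclideanSpace ℝ (Fin 3), ∀ k,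
      F k = (r k) • stPull ((r k) ^ 2) (r k) (0 : ℝ) (0 : EuclideanSpace ℝ (Fin 3))
        (fun s y => U s (y + yc k)) := ⟨_, fun _ => rfl⟩
  obtain ⟨Pk, hPk⟩ : ∃ Pk : ℕ → ℝ → EuclideanSpace ℝ (Fin 3) → ℝ, ∀ k,
      Pk k = (r k) ^ 2 • stPull ((r k) ^ 2) (r k) (0 : ℝ) (0 : EuclideanSpace ℝ (Fin 3))
        (fun s y => P s (y + yc k)) := ⟨_, fun _ => rfl⟩
  obtain ⟨Gk, hGk⟩ : ∃ Gk : ℕ → ℝ → EuclideanSpace ℝ (Fin 3) →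
      EuclideanSpace ℝ (Fin 3) →L[ℝ] EuclideanSpace ℝ (Fin 3), ∀ k,
      Gk k = (r k) ^ 2 • stPull ((r k) ^ 2) (r k) (0 : ℝ) (0 : EuclideanSpace ℝ (Fin 3))
        (fun s y => G s (y + yc k)) := ⟨_, fun _ => rfl⟩
  have hFapply : ∀ k s y, F k s y = (r k) • U ((r k) ^ 2 * s) ((r k) • y + yc k) := by
    intro k s y; rw [hF k]; simp only [Pi.smul_apply, stPull_apply, zero_add]
  have hst0 : ∀ k (z : ℝ × EuclideanSpace ℝ (Fin 3)),
      stAffine ((r k) ^ 2) (r k) (0 : ℝ) (0 : EuclideanSpace ℝ (Fin 3)) z = ((r k) ^ 2 * z.1, (r k) • z.2) := by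
    intro k z
    rw [show z = (z.1, z.2) from rfl, stAffine_apply, zero_add, zero_add]
  -- the translates
  have htr := fun k => apexPackage_translate (M := M) (D₀ := D₀) (C := C) (yc k) hsw hG hI hD hrate htop
  -- ## (i) suitability
  have hFsw : ∀ k (a : ℝ), 0 < a →
      IsSuitableWeakSolutionInBall a (0 : ℝ × EuclideanSpace ℝ (Fin 3)) (F k) (Pk k) := by
    intro k a ha
    obtain ⟨hsw', -, -, -, -, -⟩ := htr k
    have h := (hsw' (a * r k) (mul_pos ha (hr k))).zoomOut (hr k)
    rw [mul_div_cancel_right₀ a (hr k).ne'] at h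
    rw [hF k, hPk k]
    exact h
  refine ⟨F, Pk, Gk, hFsw, ?_, ?_, ?_, ?_, ?_, ?_, ?_⟩
  · -- ## (ii) weak gradients
    intro k a ha
    obtain ⟨-, hG', -, -, -, -⟩ := htr k
    have h := (hG' (a * r k) (mul_pos ha (hr k))).stRescale (r k) (pow_pos (hr k) 2) (hr k) (0 : ℝ)
      (0 : EuclideanSpace ℝ (Fin 3))
    have hpre : stPreimage ((r k) ^ 2) (r k) (0 : ℝ) (0 : EuclideanSpace ℝ (Fin 3))
        (parabolicCylinderOpens (a * r k) (0 : ℝ × EuclideanSpace ℝ (Fin 3))) =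
        parabolicCylinderOpens a (0 : ℝ × EuclideanSpace ℝ (Fin 3)) := by
      apply Opens.ext
      rw [coe_stPreimage, coe_parabolicCylinderOpens, coe_parabolicCylinderOpens,
        stAffine_preimage_parabolicCylinder_zero (hr k) (a * r k), mul_div_cancel_right₀ a (hr k).ne']
    rw [hpre, ← sq] at h
    rw [hF k, hGk k]
    exact h
  · -- ## (iii) the local Type-I bound (scale and translation invariance)
    intro k a ha
    obtain ⟨-, -, hI', -, -, -⟩ := htr k
    rw [hF k, hPk k, hGk k,
      show parabolicCylinder a (0 : ℝ × EuclideanSpace ℝ (Fin 3)) =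
        parabolicCylinder ((a * r k) / r k) (0 : ℝ × EuclideanSpace ℝ (Fin 3)) by
          rw [mul_div_cancel_right₀ a (hr k).ne'],
      ← stAffine_preimage_parabolicCylinder_zero (hr k) (a * r k), typeIBound_nsZoom (hr k)]
    exact hI' (a * r k) (mul_pos ha (hr k))
  · -- ## (iv) the pressure quantity at every apex `≤ 0`
    intro k z₀ hz₀ r' hr'
    obtain ⟨-, -, -, hD', -, -⟩ := htr k
    rw [hPk k, cknD_nsZoom (hr k) hr' 0 0 z₀]
    refine hD' _ ?_ _ (mul_pos (hr k) hr')
    rw [hst0]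
    exact mul_nonpos_of_nonneg_of_nonpos (pow_pos (hr k) 2).le hz₀
  · -- ## (v) the rate
    intro k s hs
    have hμ := hr k
    have hμ2 : 0 < r k ^ 2 := pow_pos hμ 2
    have hs2 : r k ^ 2 * s < 0 := mul_neg_of_pos_of_neg hμ2 hs
    obtain ⟨-, -, -, -, hrate', -⟩ := htr k
    have h := (Measure.quasiMeasurePreserving_smul volume hμ.ne').ae (hrate' (r k ^ 2 * s) hs2)
    filter_upwards [h] with y hy
    have hsq : Real.sqrt (-(r k ^ 2 * s)) = r k * Real.sqrt (-s) := by
      rw [show -(r k ^ 2 * s) = r k ^ 2 * (-s) by ring, Real.sqrt_mul hμ2.le, Real.sqrt_sq hμ.le]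
    have hpos : 0 < Real.sqrt (-s) := Real.sqrt_pos.2 (by linarith)
    rw [hFapply, norm_smul, Real.norm_eq_abs, abs_of_pos hμ]
    have hy' : ‖U (r k ^ 2 * s) (r k • y + yc k)‖ ≤ C / (r k * Real.sqrt (-s)) := by
      rw [← hsq]; exact hy
    calc r k * ‖U (r k ^ 2 * s) (r k • y + yc k)‖ ≤ r k * (C / (r k * Real.sqrt (-s))) :=
          mul_le_mul_of_nonneg_left hy' hμ.le
      _ = C / Real.sqrt (-s) := by field_simp
  · -- ## (vi) weak vanishing at the top
    intro k
    obtain ⟨-, -, -, -, -, htop'⟩ := htr k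
    have h := weakNull_nsZoom htop' (hr k)
    rw [← hF k] at h
    exact h
  · -- ## (vii) the late bound `4` on `]−1/16, 0[ × B(0, k + 4)` (countably many admissible cylinders)
    intro k
    set μ : ℝ := r k with hμdef
    have hμ : 0 < μ := hr k
    -- one admissible cylinder, transported to the zoom
    have hone : ∀ y : EuclideanSpace ℝ (Fin 3), ‖y‖ < (k : ℝ) + 4 →
        ∀ᵐ z ∂(volume.restrict (parabolicCylinder (1 / 4) (((0 : ℝ), y) : ℝ × EuclideanSpace ℝ (Fin 3)))),
          ‖F k z.1 z.2‖ ≤ 4 := by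
      intro y hy
      set x : EuclideanSpace ℝ (Fin 3) := yc k + μ • y with hxdef
      have hxball : x ∈ ball (yc k) (((k : ℝ) + 4) * r k) := by
        rw [mem_ball, hxdef, dist_eq_norm, add_sub_cancel_left, norm_smul, Real.norm_of_nonneg hμ.le, hμdef,
          mul_comm]
        exact mul_lt_mul_of_pos_right hy (hr k)
      have hadm := hAdm k x hxball
      have hA : MeasurableSet (parabolicCylinder (r k / 4) (((0 : ℝ), x) : ℝ × EuclideanSpace ℝ (Fin 3))) :=
        measurableSet_Ioo.prod measurableSet_ball
      have h1 := ae_restrict_comp_translate (yc k) hA hadm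
      rw [preimage_translate_parabolicCylinder_top (yc k) x] at h1
      have hxy : x - yc k = μ • y := by rw [hxdef]; abel
      rw [hxy] at h1
      have hSm : MeasurableSet (parabolicCylinder (r k / 4) (((0 : ℝ), μ • y) : ℝ × EuclideanSpace ℝ (Fin 3))) :=
        measurableSet_Ioo.prod measurableSet_ball
      have hS'm : MeasurableSet (parabolicCylinder (1 / 4) (((0 : ℝ), y) : ℝ × EuclideanSpace ℝ (Fin 3))) :=
        measurableSet_Ioo.prod measurableSet_ball
      rw [ae_restrict_iff' hSm] at h1
      rw [ae_restrict_iff' hS'm]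
      filter_upwards [(quasiMeasurePreserving_parabolicDilation hμ.ne').ae h1] with z hz hzS'
      rw [mem_parabolicCylinder] at hzS'
      have hmem : ((μ ^ 2 * z.1, μ • z.2) : ℝ × EuclideanSpace ℝ (Fin 3)) ∈
          parabolicCylinder (r k / 4) (((0 : ℝ), μ • y) : ℝ × EuclideanSpace ℝ (Fin 3)) := by
        rw [mem_parabolicCylinder]
        dsimp only at hzS' ⊢
        refine ⟨⟨?_, mul_neg_of_pos_of_neg (pow_pos hμ 2) hzS'.1.2⟩, ?_⟩
        · have h0 : 0 - (1 / 4) ^ 2 < z.1 := hzS'.1.1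
          have : μ ^ 2 * (-(1 / 4) ^ 2) < μ ^ 2 * z.1 := mul_lt_mul_of_pos_left (by linarith) (pow_pos hμ 2)
          rw [hμdef] at this ⊢
          nlinarith
        · rw [dist_eq_norm, ← smul_sub, norm_smul, Real.norm_of_nonneg hμ.le]
          have : dist z.2 y < 1 / 4 := hzS'.2
          rw [dist_eq_norm] at this
          rw [hμdef]
          nlinarith [hr k]
      have hb := hz hmem
      rw [hFapply, norm_smul, Real.norm_of_nonneg (hr k).le, add_comm (r k • z.2) (yc k)]
      have hinv : (r k / 4)⁻¹ = 4 / r k := by rw [inv_div]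
      rw [hinv] at hb
      have hb' : ‖U (r k ^ 2 * z.1) (yc k + r k • z.2)‖ ≤ 4 / r k := by
        have e : yc k + r k • z.2 = μ • z.2 + yc k := by rw [hμdef, add_comm]
        rw [e, ← hμdef]; exact hb
      have hrk0 : r k ≠ 0 := (hr k).ne'
      calc r k * ‖U (r k ^ 2 * z.1) (yc k + r k • z.2)‖ ≤ r k * (4 / r k) := mul_le_mul_of_nonneg_left hb' (hr k).le
        _ = 4 := by field_simp
    -- a countable dense set of centres
    set O : Set (EuclideanSpace ℝ (Fin 3)) := ball (0 : EuclideanSpace ℝ (Fin 3)) ((k : ℝ) + 4) with hOdef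
    have hOo : IsOpen O := isOpen_ball
    obtain ⟨Dc, hDc, hDd⟩ := TopologicalSpace.exists_countable_dense (EuclideanSpace ℝ (Fin 3))
    have hcov : Ioo (-(1 / 16 : ℝ)) 0 ×ˢ O ⊆
        ⋃ y ∈ Dc ∩ O, parabolicCylinder (1 / 4) (((0 : ℝ), y) : ℝ × EuclideanSpace ℝ (Fin 3)) := by
      rintro ⟨s, y'⟩ ⟨hs, hy'⟩
      have hopen : IsOpen (O ∩ ball y' (1 / 4)) := hOo.inter isOpen_ball
      have hne' : (O ∩ ball y' (1 / 4)).Nonempty := ⟨y', hy', mem_ball_self (by norm_num)⟩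
      obtain ⟨y, hyD, hyO, hyb⟩ := hDd.exists_mem_open hopen hne'
      refine mem_iUnion₂.2 ⟨y, ⟨hyD, hyO⟩, ?_⟩
      rw [mem_parabolicCylinder]
      refine ⟨⟨?_, by simpa using hs.2⟩, ?_⟩
      · have : -(1 / 16 : ℝ) < s := hs.1
        show (0 : ℝ) - (1 / 4) ^ 2 < s
        linarith
      · rw [mem_ball, dist_comm] at hyb
        simpa using hyb
    refine ae_restrict_of_ae_restrict_of_subset hcov ?_
    rw [ae_restrict_biUnion_iff _ (hDc.mono inter_subset_left)]
    rintro y ⟨-, hyO⟩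
    exact hone y (by simpa [hOdef] using hyO)
  · -- ## (viii) the failure of the bound `1/2` on `Q_2(0)` (transport of the failure of `Adm(2 r_k)`)
    intro k hk
    apply hnot k
    set μ : ℝ := r k with hμdef
    have hμ : 0 < μ := hr k
    have hμ0 : μ ≠ 0 := hμ.ne'
    -- dilate by `μ⁻¹`: the bound on `Q_{2μ}(0, 0)` for `(s, y) ↦ U s (y + yc)`
    have hSm : MeasurableSet (parabolicCylinder 2 (0 : ℝ × EuclideanSpace ℝ (Fin 3))) :=
      (isOpen_parabolicCylinder _ _).measurableSet
    have hS'm : MeasurableSet (parabolicCylinder (2 * r k)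
        (((0 : ℝ), (0 : EuclideanSpace ℝ (Fin 3))) : ℝ × EuclideanSpace ℝ (Fin 3))) :=
      (isOpen_parabolicCylinder _ _).measurableSet
    rw [ae_restrict_iff' hSm] at hk
    have hmid : ∀ᵐ z ∂(volume.restrict (parabolicCylinder (2 * r k)
        (((0 : ℝ), (0 : EuclideanSpace ℝ (Fin 3))) : ℝ × EuclideanSpace ℝ (Fin 3)))),
        ‖U z.1 (z.2 + yc k)‖ ≤ (2 * r k)⁻¹ := by
      rw [ae_restrict_iff' hS'm]
      filter_upwards [(quasiMeasurePreserving_parabolicDilation (inv_ne_zero hμ0)).ae hk] with z hz hzS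
      rw [mem_parabolicCylinder] at hzS
      dsimp only at hzS
      have hmem : ((μ⁻¹ ^ 2 * z.1, μ⁻¹ • z.2) : ℝ × EuclideanSpace ℝ (Fin 3)) ∈
          parabolicCylinder 2 (0 : ℝ × EuclideanSpace ℝ (Fin 3)) := by
        rw [SuitableCompactness.mem_parabolicCylinder_zero]
        dsimp only
        have hμ2 : 0 < μ⁻¹ ^ 2 := pow_pos (inv_pos.2 hμ) 2
        refine ⟨⟨?_, mul_neg_of_pos_of_neg hμ2 (by linarith [hzS.1.2])⟩, ?_⟩
        · have h0 : 0 - (2 * r k) ^ 2 < z.1 := hzS.1.1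
          rw [inv_pow, inv_mul_eq_div, lt_div_iff₀ (pow_pos hμ 2), hμdef]
          nlinarith
        · rw [norm_smul, Real.norm_of_nonneg (inv_pos.2 hμ).le, ← div_eq_inv_mul, div_lt_iff₀ hμ, hμdef]
          have : dist z.2 0 < 2 * r k := hzS.2
          rw [dist_zero_right] at this
          linarith
      have hb := hz hmem
      rw [hFapply, inv_pow, ← mul_assoc, ← hμdef, mul_inv_cancel₀ (pow_ne_zero 2 hμ0), one_mul, smul_smul,
        mul_inv_cancel₀ hμ0, one_smul, norm_smul, Real.norm_of_nonneg hμ.le] at hb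
      rw [show (2 * μ)⁻¹ = μ⁻¹ * 2⁻¹ by rw [mul_inv, mul_comm]]
      rw [le_inv_mul_iff₀' hμ, mul_comm]
      exact hb
    -- translate by `yc`
    have hA : MeasurableSet (parabolicCylinder (2 * r k)
        (((0 : ℝ), (0 : EuclideanSpace ℝ (Fin 3))) : ℝ × EuclideanSpace ℝ (Fin 3))) := hS'm
    have h1 := ae_restrict_comp_translate (-yc k) hA hmid
    rw [preimage_translate_parabolicCylinder_top (-yc k) 0, sub_neg_eq_add, zero_add] at h1
    filter_upwards [h1] with z hz
    simpa using hz

end Summit.NavierStokesRegularity.NavierStokesRegularity.Theorems.TypeITraceScarL3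

end
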